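import Mathlib.AlgebraicGeometry.EllipticCurve.Affine.Point
import Mathlib.Tactic
import HarnessLib

/-!
# The Frey curve of Bennett–Vatsal–Yazdani for `A xⁿ + B yⁿ = C z³` and its invariants

M. A. Bennett, V. Vatsal, S. Yazdani, *Ternary Diophantine equations of signature (p, p, 3)*,
Compos. Math. **140** (2004) 1399–1416 [BennettVatsalYazdani2004], §2, p. 1401. Standing
hypotheses (verbatim): *"`A aⁿ + B bⁿ = C c³` for some prime integer `n ≥ 5`. Assume `Aa`, `Bb`, and
`Cc` are pairwise coprime, and, without loss of generality, that `Aa ≢ 0 (mod 3)` and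
`B bⁿ ≢ 2 (mod 3)`. Further, suppose that `C` is cube free and that `A` and `B` are nth power
free."* The curve (2): *"`E = E(a, b, c) : y² + 3Cc·xy + C²B bⁿ·y = x³`."* **Lemma 2.1**
(verbatim): *"i) The discriminant `Δ(E)` of the curve `E` is given by `Δ(E) = 3³AB³C⁸(ab³)ⁿ`, while
the j-invariant `j(E)` satisfies `j(E) = 3³Cc³(9Aaⁿ + Bbⁿ)³ / (AB³(ab³)ⁿ)`. ii) The conductor
`N(E)` of the curve `E` is `N(E) = Rad*(ABab) Rad*(C)² ε₃` … iii) The curve `E` has a `ℚ`-rational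
point of order 3."*

This file TYPES the curve (2) as a `WeierstrassCurve` (`a₁ = 3Cc`, `a₃ = C²B bⁿ`,
`a₂ = a₄ = a₆ = 0`) over any commutative ring and PROVES, as polynomial identities from
`A aⁿ + B bⁿ = C c³`: Lemma 2.1 i) — the discriminant (`Δ_E`), the closed form
`c₄ = 9C³c(9Aaⁿ + Bbⁿ)` (`c₄_E_of_rel`) and the j-invariant over a field (`j_E`) — and Lemma 2.1
iii): `(0, 0)` is a nonsingular point `P` with `P + P = −P`, i.e. of order `3` (`threeTorsion_E`).
NOT here: ii) (the conductor / `ε₃` — Tate's algorithm is not in Mathlib), Corollary 2.2, and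
anything about the mod-`n` representation.
-/

namespace Literature.NumberTheory.DiophantineGeometry

namespace BennettVatsalYazdani2004

open WeierstrassCurve

section Ring

variable {R : Type*} [CommRing R]

/-- The Frey curve (2) of [BVY04]: `E(a, b, c) : y² + 3Cc·xy + C²B bⁿ·y = x³`
(`a₁ = 3Cc`, `a₂ = 0`, `a₃ = C²B bⁿ`, `a₄ = a₆ = 0`). [cite: BennettVatsalYazdani2004, §2 eq. (2) (p. 1401)] -/
def E (B C b c : R) (n : ℕ) : WeierstrassCurve R :=
  { a₁ := 3 * C * c, a₂ := 0, a₃ := C ^ 2 * B * b ^ n, a₄ := 0, a₆ := 0 }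

variable (B C b c : R) (n : ℕ)

/-- `a₁(E) = 3Cc` (as printed). [cite: BennettVatsalYazdani2004, §2 eq. (2)] -/
@[simp] theorem E_a₁ : (E B C b c n).a₁ = 3 * C * c := rfl
/-- `a₂(E) = 0` (as printed). [cite: BennettVatsalYazdani2004, §2 eq. (2)] -/
@[simp] theorem E_a₂ : (E B C b c n).a₂ = 0 := rfl
/-- `a₃(E) = C²B bⁿ` (as printed). [cite: BennettVatsalYazdani2004, §2 eq. (2)] -/
@[simp] theorem E_a₃ : (E B C b c n).a₃ = C ^ 2 * B * b ^ n := rfl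
/-- `a₄(E) = 0` (as printed). [cite: BennettVatsalYazdani2004, §2 eq. (2)] -/
@[simp] theorem E_a₄ : (E B C b c n).a₄ = 0 := rfl
/-- `a₆(E) = 0` (as printed). [cite: BennettVatsalYazdani2004, §2 eq. (2)] -/
@[simp] theorem E_a₆ : (E B C b c n).a₆ = 0 := rfl

/-- `b₂(E) = 9C²c²`. [cite: BennettVatsalYazdani2004, Lemma 2.1 (proof, Tate's algorithm data)] -/
theorem b₂_E : (E B C b c n).b₂ = 9 * C ^ 2 * c ^ 2 := by
  simp [WeierstrassCurve.b₂]; ring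

/-- `b₄(E) = 3C³c·B bⁿ`. [cite: BennettVatsalYazdani2004, Lemma 2.1 (proof)] -/
theorem b₄_E : (E B C b c n).b₄ = 3 * C ^ 3 * c * B * b ^ n := by
  simp [WeierstrassCurve.b₄]; ring

/-- `b₆(E) = C⁴B² b²ⁿ`. [cite: BennettVatsalYazdani2004, Lemma 2.1 (proof)] -/
theorem b₆_E : (E B C b c n).b₆ = (C ^ 2 * B * b ^ n) ^ 2 := by
  simp [WeierstrassCurve.b₆]

/-- `b₈(E) = 0`. [cite: BennettVatsalYazdani2004, Lemma 2.1 (proof)] -/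
theorem b₈_E : (E B C b c n).b₈ = 0 := by
  simp [WeierstrassCurve.b₈]

/-- `c₄(E) = 9C³c·(9Cc³ − 8B bⁿ)`. [cite: BennettVatsalYazdani2004, Lemma 2.1 i) (j-invariant numerator)] -/
theorem c₄_E : (E B C b c n).c₄ = 9 * C ^ 3 * c * (9 * C * c ^ 3 - 8 * B * b ^ n) := by
  simp only [WeierstrassCurve.c₄, b₂_E, b₄_E]; ring

/-- The discriminant before using the ternary relation:
`Δ(E) = 27·C⁸B³ b³ⁿ·(Cc³ − B bⁿ)`. [cite: BennettVatsalYazdani2004, Lemma 2.1 i)] -/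
theorem Δ_E' : (E B C b c n).Δ = 27 * C ^ 8 * B ^ 3 * b ^ (3 * n) * (C * c ^ 3 - B * b ^ n) := by
  simp only [WeierstrassCurve.Δ, b₂_E, b₄_E, b₆_E, b₈_E]; ring

/-- **Lemma 2.1 i), discriminant**: if `A aⁿ + B bⁿ = C c³` then `Δ(E(a,b,c)) = 3³AB³C⁸(ab³)ⁿ`.
[cite: BennettVatsalYazdani2004, Lemma 2.1 i)] -/
theorem Δ_E {A B C a b c : R} {n : ℕ} (h : A * a ^ n + B * b ^ n = C * c ^ 3) :
    (E B C b c n).Δ = 3 ^ 3 * A * B ^ 3 * C ^ 8 * (a * b ^ 3) ^ n := by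
  rw [Δ_E', show b ^ (3 * n) = (b ^ n) ^ 3 by ring, show (a * b ^ 3) ^ n = a ^ n * (b ^ n) ^ 3 by ring]
  linear_combination (-(27 * C ^ 8 * B ^ 3 * (b ^ n) ^ 3)) * h

/-- With the ternary relation, `c₄(E) = 9C³c·(9A aⁿ + B bⁿ)` (so that
`c₄³ = 3⁶C⁹c³(9Aaⁿ + Bbⁿ)³`, the printed numerator of `j` times `3³C⁸`).
[cite: BennettVatsalYazdani2004, Lemma 2.1 i)] -/
theorem c₄_E_of_rel {A B C a b c : R} {n : ℕ} (h : A * a ^ n + B * b ^ n = C * c ^ 3) :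
    (E B C b c n).c₄ = 9 * C ^ 3 * c * (9 * A * a ^ n + B * b ^ n) := by
  rw [c₄_E]; linear_combination (-(81 * C ^ 3 * c)) * h

end Ring

section Field

variable {K : Type*} [Field K]

/-- `E` is an elliptic curve (non-zero discriminant) as soon as `3abABC ≠ 0` in the field.
[cite: BennettVatsalYazdani2004, §2 (curve (2) is an elliptic curve under the standing hypotheses)] -/
theorem Δ_E_ne_zero {A B C a b c : K} {n : ℕ} (h : A * a ^ n + B * b ^ n = C * c ^ 3)
    (h3 : (3 : K) ≠ 0) (hA : A ≠ 0) (hB : B ≠ 0) (hC : C ≠ 0) (ha : a ≠ 0) (hb : b ≠ 0) :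
    (E B C b c n).Δ ≠ 0 := by
  rw [Δ_E h]
  have hab : (a * b ^ 3) ^ n ≠ 0 := pow_ne_zero n (mul_ne_zero ha (pow_ne_zero 3 hb))
  exact mul_ne_zero (mul_ne_zero (mul_ne_zero (mul_ne_zero (pow_ne_zero 3 h3) hA)
    (pow_ne_zero 3 hB)) (pow_ne_zero 8 hC)) hab

/-- **Lemma 2.1 i), j-invariant** (over a field, `E` elliptic):
`j(E) = 3³Cc³(9Aaⁿ + Bbⁿ)³ / (AB³(ab³)ⁿ)`. [cite: BennettVatsalYazdani2004, Lemma 2.1 i)] -/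
theorem j_E {A B C a b c : K} {n : ℕ} [hE : (E B C b c n).IsElliptic]
    (h : A * a ^ n + B * b ^ n = C * c ^ 3) :
    (E B C b c n).j = 3 ^ 3 * C * c ^ 3 * (9 * A * a ^ n + B * b ^ n) ^ 3 /
      (A * B ^ 3 * (a * b ^ 3) ^ n) := by
  have hΔ : (E B C b c n).Δ ≠ 0 := (E B C b c n).isUnit_Δ.ne_zero
  have hΔ' := hΔ
  rw [Δ_E h] at hΔ'
  -- all factors of `Δ = 3³AB³C⁸(ab³)ⁿ` are non-zero
  have h3 : (3 : K) ^ 3 ≠ 0 := by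
    intro h0; apply hΔ'; rw [h0]; ring
  have hA : A ≠ 0 := by intro h0; apply hΔ'; rw [h0]; ring
  have hB : B ≠ 0 := by intro h0; apply hΔ'; rw [h0]; ring
  have hC : C ≠ 0 := by intro h0; apply hΔ'; rw [h0]; ring
  have hab : (a * b ^ 3) ^ n ≠ 0 := by intro h0; apply hΔ'; rw [h0]; ring
  have hden : A * B ^ 3 * (a * b ^ 3) ^ n ≠ 0 := mul_ne_zero (mul_ne_zero hA (pow_ne_zero 3 hB)) hab
  rw [WeierstrassCurve.j, Units.val_inv_eq_inv_val, WeierstrassCurve.coe_Δ', Δ_E h,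
    c₄_E_of_rel h, inv_mul_eq_div, div_eq_div_iff hΔ' hden]
  ring

variable [DecidableEq K]

omit [DecidableEq K] in
/-- `(0, 0)` is a nonsingular point of `E` as soon as `a₃ = C²B bⁿ ≠ 0`.
[cite: BennettVatsalYazdani2004, Lemma 2.1 iii)] -/
theorem nonsingular_zero_E {B C b c : K} {n : ℕ} (hB : B ≠ 0) (hC : C ≠ 0) (hb : b ≠ 0) :
    (E B C b c n).toAffine.Nonsingular 0 0 :=
  (WeierstrassCurve.Affine.nonsingular_zero).2
    ⟨rfl, Or.inl (by simp [hB, hC, hb])⟩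

/-- **Lemma 2.1 iii)**: the point `P = (0, 0)` of `E` satisfies `P ≠ 0` and `P + P = −P`, i.e. it
is a rational point of order `3` (the tangent `y = 0` at `P` meets `E` only at `P`).
[cite: BennettVatsalYazdani2004, Lemma 2.1 iii)] -/
theorem threeTorsion_E {B C b c : K} {n : ℕ} (hB : B ≠ 0) (hC : C ≠ 0) (hb : b ≠ 0) :
    WeierstrassCurve.Affine.Point.some 0 0 (nonsingular_zero_E (c := c) (n := n) hB hC hb) ≠ 0 ∧
      WeierstrassCurve.Affine.Point.some 0 0 (nonsingular_zero_E (c := c) (n := n) hB hC hb) +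
          WeierstrassCurve.Affine.Point.some 0 0 (nonsingular_zero_E (c := c) (n := n) hB hC hb) =
        -WeierstrassCurve.Affine.Point.some 0 0 (nonsingular_zero_E (c := c) (n := n) hB hC hb) := by
  have ha3 : (E B C b c n).a₃ ≠ 0 := by simp [hB, hC, hb]
  have hy : (0 : K) ≠ (E B C b c n).toAffine.negY 0 0 := by
    simp [WeierstrassCurve.Affine.negY, hB, hC, hb]
  refine ⟨WeierstrassCurve.Affine.Point.some_ne_zero _, ?_⟩
  rw [WeierstrassCurve.Affine.Point.add_self_of_Y_ne' hy, neg_inj]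
  have hs : (E B C b c n).toAffine.slope 0 0 0 0 = 0 := by
    rw [WeierstrassCurve.Affine.slope_of_Y_ne rfl hy]; simp
  simp only [WeierstrassCurve.Affine.Point.some.injEq]
  constructor <;> simp [hs, WeierstrassCurve.Affine.addX, WeierstrassCurve.Affine.negAddY]

end Field

end BennettVatsalYazdani2004

end Literature.NumberTheory.DiophantineGeometry
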